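import Summits.BirchSwinnertonDyer.BirchSwinnertonDyer.Theorems.EisensteinPrimesMazurMCOnCellBKummerCharacterCountOfTorsion
import Summits.BirchSwinnertonDyer.Rank1Residual.Additive.BudgetFromRelaxedKummerCount
import HarnessLib

/-!
# STACKING the Kummer-character classes with the Tamagawa count: Poitou–Tate pair counting KEEPING
# the dual Selmer group, and strict Kummer classes inside `H¹_{𝓖*}(K, E[p]^D)`
# (route `EisensteinPrimes`, crux 3 `MazurMCOnCellB` = stmt-BirchSwinnertonDyer-19033, line `mudescent`,
# stub 4″ `stub_lambdaCountWeak_offLocus`, ALGEBRAIC half; width seat bsd-line-x2-p1-w3, D-0154 row 5)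

HONEST FRAMING (cell `bsd-eis`; nothing here proves BSD or a main conjecture; 0 cells move): THEOREMS
ONLY — no definition, no named fact, nothing asserted about any particular curve, closes nothing. The
Kummer-character socket (p630234/p630799/p631949-lineage) counts the GLOBAL classes `[σ ↦ χ(σ)·P̃]`;
lam-b's socket (`EisensteinPrimesX2GeneratorCountAtP`, over eisenstein-p1's
`X1.GeneratorCountLayerAtP.exists_addSubgroup_relaxedKummer_at`) counts `p^{#T₀+1}` RELAXED classes by
Poitou–Tate pair counting (Wiles / DDT 2.19: `#H¹_𝓖 · #H¹_{𝓚*} · ∏ #𝓚_v = #H¹_𝓚 · #H¹_{𝓖*} · ∏ #𝓖_v`)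
and DROPS the factor `#H¹_{𝓖*}(K, E[p]^D) ≥ 1`. The two do not add naively (`#H¹_𝓖 = p^{#T₀+1}·#H¹_{𝓖*}`
exactly); they STACK through that dropped factor: a Kummer-character class that is `0` at the places of
`T₁ = T₀ ∪ {𝔭}` and Kummer elsewhere lies, after the Weil-pairing transport `θ_* : H¹(E[p]) → H¹(E[p]^D)`,
in the dual Selmer group `H¹_{𝓖*}`. This file is the number-field machinery (the `ℚ`-socket follows):

* §1 `pow_mul_le_card_selmerGroup_of_kummer_le` — n1011's `Additive.finite_and_pow_le_card_selmerGroup_of_kummer_le`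
  with the dual factor kept: an injection `ι ↪ H¹_{𝓖*}(K, E[p]^D)` gives `#H¹_𝓖 ≥ p^{#T₀} · #ι`.
* §2 `map_weilDual_mem_dualSelmerGroup_of_kummer_of_eq_zero` — for `𝓖 = 𝓚` off `T₁`: a class Kummer
  off `T₁` and `0` on `T₁` maps under `θ_*` into `H¹_{𝓖*}` (infinite places: `H¹ = 0` for odd `p`; off
  `T₁`: `θ⁻¹(𝓚_v^*) = 𝓚_v`, n1011-p18's `dualTransported_kummerSelmerStructure_inr`; on `T₁`: `0`).
* §3 `exists_addSubgroup_relaxedKummer_at_of_strict` — eisenstein-p1's relaxed-subgroup existence with an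
  injective family of strict classes counted: `#S ≥ p^{#T₀+1} · #ι`, same four membership properties.

Named PUBLISHED facts enter as in the originals (Poitou–Tate family `inv`, local Euler–Poincaré `hEP`);
the Weil pairing and `#E[p] = p²` are tree theorems. References: [MilneADT2006] I Thm. 2.8, Cor. 3.4,
Thm. 4.10; [GreenbergLNM1716] §5 pp. 114–118; [Sakamoto2024] §3.1.2 (residual self-duality);
DDT Thm. 2.19 (Wiles' formula).
-/

set_option autoImplicit false
-- `Summit.BirchSwinnertonDyer.BirchSwinnertonDyer.…`: the summit and its single sub-problem share a name (D-0017 layout).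
set_option linter.dupNamespace false

noncomputable section

open scoped Classical

open Function Field NumberField IsDedekindDomain WeierstrassCurve
  Literature.NumberTheory.EllipticCurves Literature.NumberTheory.GaloisRepresentations
  Literature.NumberTheory.GaloisCohomology
  Literature.NumberTheory.EllipticCurves.Rank1Residual Literature.NumberTheory.EllipticCurves.ModularForms
  Summit.BirchSwinnertonDyer.Rank1Residual
  Summit.BirchSwinnertonDyer.Rank1Residual.GaloisImage
  Summit.BirchSwinnertonDyer.Rank1Residual.X1.GeneratorCountSqueeze
  Summit.BirchSwinnertonDyer.Rank1Residual.X1.TamagawaSqueeze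
  Summit.BirchSwinnertonDyer.BirchSwinnertonDyer.Theorems.EisensteinPrimesAlgebraicLambdaGEBudget
  Summit.BirchSwinnertonDyer.BirchSwinnertonDyer.Theorems.EisensteinPrimesX2GeneratorCountAtP
  Summit.BirchSwinnertonDyer.BirchSwinnertonDyer.Theorems.EisensteinPrimesX2AlgebraicLambdaGESplitTorsion
  Summit.BirchSwinnertonDyer.BirchSwinnertonDyer.Theorems.EisensteinPrimesMazurMCOnCellBKummerCharacterCocycles
  Summit.BirchSwinnertonDyer.BirchSwinnertonDyer.Theorems.EisensteinPrimesMazurMCOnCellBKummerPlaceClasses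
  Summit.BirchSwinnertonDyer.BirchSwinnertonDyer.Theorems.EisensteinPrimesMazurMCOnCellBKummerCharacterCountOfTorsion
open Literature.NumberTheory.GaloisRepresentations.DiscreteGaloisModule (SelmerStructure unramifiedSubgroup)
open Summit.BirchSwinnertonDyer.Rank1Residual.X11b.Levels Summit.BirchSwinnertonDyer.Rank1Residual.X11b.LocBridge

universe u

namespace Summit.BirchSwinnertonDyer.BirchSwinnertonDyer.Theorems.EisensteinPrimesMazurMCOnCellBKummerCharacterCountStacked

/-! ## §1. Pair counting against the Kummer structure WITH the dual Selmer group kept -/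

section Count

variable {K : Type u} [Field K] [NumberField K] (W : WeierstrassCurve K) [W.IsElliptic] (p : ℕ)
  [hp : Fact p.Prime]

/-- **Pair counting against the Kummer structure, keeping the dual Selmer group.** `p` odd, `𝓚` the
Kummer structure on `E[p]`, `𝓖 ≥ 𝓚` agreeing with `𝓚` at infinity, both unramified outside `S(T)`;
`#𝓖_v ≥ p·#𝓚_v` on `T₀ ⊆ T`; and an INJECTION `f : ι ↪ H¹_{𝓖*}(K, E[p]^D)` from a finite type. Then
`H¹_𝓖(K, E[p])` is finite and **`#H¹_𝓖 ≥ p^{#T₀} · #ι`** — Wiles' formula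
(`GaloisImage.card_selmerGroup_pair`) and `#H¹_𝓚 = #H¹_{𝓚*}` (`natCard_selmerGroup_kummer_eq_dual`)
exactly as in `Additive.finite_and_pow_le_card_selmerGroup_of_kummer_le`, whose `#H¹_{𝓖*} ≥ 1` is
replaced by `#H¹_{𝓖*} ≥ #ι`.
-- adapted from Summits/BirchSwinnertonDyer/Rank1Residual/Additive/BudgetFromRelaxedKummerCount.lean
[cite: MilneADT2006, Ch. I Thm. 4.10 and Thm. 2.8] -/
theorem pow_mul_le_card_selmerGroup_of_kummer_le [Finite (geomTorsion W (p : ℤ))] (hodd : p ≠ 2)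
    (inv : LocalInvariants K p) (hperf : inv.IsPerfect) (hsum : inv.SumLocalTermEqZero)
    (hcompl : inv.SelmerComplement)
    (hEP : ∀ v : HeightOneSpectrum (𝓞 K), localEulerPoincareCharacteristic (v.adicCompletion K))
    (T : Finset (HeightOneSpectrum (𝓞 K)))
    (hS : ∀ v ∉ T, ((p : ℕ) : 𝓞 K) ∉ v.asIdeal ∧
      GaloisRep.IsUnramifiedAt v (W.torsionGaloisModule (p : ℤ)))
    (h𝓚 : (W.kummerSelmerStructure (p : ℤ)).IsUnramifiedOutside (finSupport T))
    {𝓖 : SelmerStructure (W.torsionGaloisModule (p : ℤ))} (hle : W.kummerSelmerStructure (p : ℤ) ≤ 𝓖)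
    (h𝓖 : 𝓖.IsUnramifiedOutside (finSupport T))
    (hinf : ∀ w : InfinitePlace K, W.kummerSelmerStructure (p : ℤ) (Sum.inl w) = 𝓖 (Sum.inl w))
    (T₀ : Finset (HeightOneSpectrum (𝓞 K))) (hT₀ : T₀ ⊆ T)
    (hbig : ∀ v ∈ T₀, p * Nat.card (W.kummerSelmerStructure (p : ℤ) (Sum.inr v)) ≤
      Nat.card (𝓖 (Sum.inr v)))
    {ι : Type} [Finite ι]
    (f : ι → (inv.dualSelmerStructure (W.torsionGaloisModule (p : ℤ)) 𝓖).selmerGroup)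
    (hf : Injective f) :
    Finite 𝓖.selmerGroup ∧ p ^ T₀.card * Nat.card ι ≤ Nat.card 𝓖.selmerGroup := by
  haveI : NeZero p := ⟨hp.out.ne_zero⟩
  set r : ℕ := Nat.card ι with hrdef
  haveI hfinK : Finite (W.kummerSelmerStructure (p : ℤ)).selmerGroup := by
    rw [← selmerGroup_eq_selmerGroup_kummerSelmerStructure]
    exact finite_selmerGroup_holds W (by exact_mod_cast hp.out.ne_zero)
  obtain ⟨e, hμ, hadd₁, hadd₂, halt, hnondeg, hgal⟩ :=
    exists_weilPairing_holds W p hp.out.two_le (Nat.cast_ne_zero.mpr hp.out.ne_zero)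
  have hinv : ∀ v : HeightOneSpectrum (𝓞 K), Injective (inv (Sum.inr v)) :=
    fun v ↦ (hperf v).1.injective
  have hself := natCard_selmerGroup_kummer_eq_dual W p e hμ hadd₁ hadd₂ hgal halt hnondeg
    hp.out.isPrimePow (hp.out.odd_of_ne_two hodd) inv hinv hEP
  have hM : ∀ m : geomTorsion W (p : ℤ), p • m = 0 := fun m ↦ Subtype.ext <| by
    rw [AddSubgroupClass.coe_nsmul, ZeroMemClass.coe_zero]
    exact AddSubgroup.torsionBy.nsmul_iff.mp m.2
  have hpair := card_selmerGroup_pair (W.torsionGaloisModule (p : ℤ)) T inv hperf hsum hcompl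
    hM hS hle h𝓚 h𝓖 hinf
  rw [← hself] at hpair
  have ha : 0 < Nat.card (W.kummerSelmerStructure (p : ℤ)).selmerGroup := Nat.card_pos
  haveI : Finite (inv.dualSelmerStructure (W.torsionGaloisModule (p : ℤ))
      (W.kummerSelmerStructure (p : ℤ))).selmerGroup :=
    Nat.finite_of_card_ne_zero (hself ▸ ha.ne')
  haveI : Finite (inv.dualSelmerStructure (W.torsionGaloisModule (p : ℤ)) 𝓖).selmerGroup :=
    Finite.of_injective _ (AddSubgroup.inclusion_injective
      (LocalInvariants.selmerGroup_dualSelmerStructure_anti inv (W.torsionGaloisModule (p : ℤ)) hle))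
  have hr : r ≤ Nat.card (inv.dualSelmerStructure (W.torsionGaloisModule (p : ℤ)) 𝓖).selmerGroup :=
    Nat.card_le_card_of_injective f hf
  have hlocfin : ∀ v : HeightOneSpectrum (𝓞 K),
      Finite (galoisCohomology ((W.torsionGaloisModule (p : ℤ)).toLocal (Sum.inr v)) 1) :=
    fun v ↦ finite_galoisCohomology_one_toLocal _ v
  have hPK : 0 < ∏ v ∈ T, Nat.card (W.kummerSelmerStructure (p : ℤ) (Sum.inr v)) := by
    refine Finset.prod_pos fun v _ ↦ ?_
    haveI := hlocfin v
    exact Nat.card_pos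
  -- `∏_T #𝓖_v ≥ p^{#T₀} · ∏_T #𝓚_v`
  have hprod : p ^ T₀.card * ∏ v ∈ T, Nat.card (W.kummerSelmerStructure (p : ℤ) (Sum.inr v)) ≤
      ∏ v ∈ T, Nat.card (𝓖 (Sum.inr v)) := by
    have hc : ∏ v ∈ T, (if v ∈ T₀ then p else 1) = p ^ T₀.card := by
      rw [Finset.prod_ite_mem, Finset.inter_eq_right.mpr hT₀, Finset.prod_const]
    rw [← hc, ← Finset.prod_mul_distrib]
    refine Finset.prod_le_prod (fun v _ ↦ Nat.zero_le _) fun v _ ↦ ?_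
    haveI := hlocfin v
    split_ifs with hv
    · exact hbig v hv
    · rw [one_mul]
      exact AddSubgroup.card_le_of_le (hle (Sum.inr v))
  -- conclude: `#Sel_𝓖 · ∏ #𝓚_v = #Sel_{𝓖*} · ∏ #𝓖_v ≥ r · p^{#T₀} · ∏ #𝓚_v`
  have hkey : p ^ T₀.card * r * ∏ v ∈ T, Nat.card (W.kummerSelmerStructure (p : ℤ) (Sum.inr v)) ≤
      Nat.card 𝓖.selmerGroup *
        ∏ v ∈ T, Nat.card (W.kummerSelmerStructure (p : ℤ) (Sum.inr v)) := by
    have h1 : Nat.card 𝓖.selmerGroup *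
        ∏ v ∈ T, Nat.card (W.kummerSelmerStructure (p : ℤ) (Sum.inr v)) =
        Nat.card (inv.dualSelmerStructure (W.torsionGaloisModule (p : ℤ)) 𝓖).selmerGroup *
          ∏ v ∈ T, Nat.card (𝓖 (Sum.inr v)) := by
      refine Nat.eq_of_mul_eq_mul_left ha ?_
      calc Nat.card (W.kummerSelmerStructure (p : ℤ)).selmerGroup * (Nat.card 𝓖.selmerGroup *
              ∏ v ∈ T, Nat.card (W.kummerSelmerStructure (p : ℤ) (Sum.inr v)))
          = Nat.card 𝓖.selmerGroup * Nat.card (W.kummerSelmerStructure (p : ℤ)).selmerGroup *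
              ∏ v ∈ T, Nat.card (W.kummerSelmerStructure (p : ℤ) (Sum.inr v)) := by ring
        _ = _ := hpair
        _ = _ := by ring
    rw [h1]
    calc p ^ T₀.card * r * ∏ v ∈ T, Nat.card (W.kummerSelmerStructure (p : ℤ) (Sum.inr v))
        = r * (p ^ T₀.card * ∏ v ∈ T, Nat.card (W.kummerSelmerStructure (p : ℤ) (Sum.inr v))) := by
          ring
      _ ≤ Nat.card (inv.dualSelmerStructure (W.torsionGaloisModule (p : ℤ)) 𝓖).selmerGroup *
            ∏ v ∈ T, Nat.card (𝓖 (Sum.inr v)) := Nat.mul_le_mul hr hprod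
  have hG : p ^ T₀.card * r ≤ Nat.card 𝓖.selmerGroup := Nat.le_of_mul_le_mul_right hkey hPK
  refine ⟨?_, hG⟩
  by_cases hr0 : r = 0
  · -- finiteness from the `r = 1`-free count: reuse the tree's theorem
    exact (Additive.finite_and_pow_le_card_selmerGroup_of_kummer_le W p hodd inv hperf hsum hcompl hEP T
      hS h𝓚 hle h𝓖 hinf T₀ hT₀ hbig).1
  · exact Nat.finite_of_card_ne_zero (Nat.pos_iff_ne_zero.mp
      (lt_of_lt_of_le (Nat.mul_pos (pow_pos hp.out.pos _) (Nat.pos_of_ne_zero hr0)) hG))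

end Count

/-! ## §2. Strict Kummer classes lie in the dual Selmer group `H¹_{𝓖*}(K, E[p]^D)` -/

section Dual

variable {K : Type u} [Field K] [NumberField K] (W : WeierstrassCurve K) [W.IsElliptic] (p : ℕ)
  [hp : Fact p.Prime] [Finite (geomTorsion W (p : ℤ))]
  (e : geomTorsion W (p : ℤ) → geomTorsion W (p : ℤ) → AlgebraicClosure K)
  (hμ : ∀ S T, e S T ^ p = 1)
  (hadd₁ : ∀ S₁ S₂ T, e (S₁ + S₂) T = e S₁ T * e S₂ T)
  (hadd₂ : ∀ S T₁ T₂, e S (T₁ + T₂) = e S T₁ * e S T₂)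
  (hgal : ∀ (σ : absoluteGaloisGroup K) (S T : geomTorsion W (p : ℤ)), σ • e S T = e (σ • S) (σ • T))
  (halt : ∀ T, e T T = 1) (hnondeg : ∀ T, (∀ S, e S T = 1) → T = 0)

include halt hnondeg in
/-- **Strict Kummer classes lie in the dual Selmer group.** `p` odd, Weil pairing data `e` on `E[p]`
with transport `θ = weilDualIntertwining`, `𝓖` a Selmer structure equal to the Kummer structure off a
finite set `T₁` of finite places, and `y ∈ H¹(K, E[p])` Kummer at every finite `v ∉ T₁` and with
localisation `0` at every `v ∈ T₁`. Then `θ_* y ∈ H¹_{𝓖*}(K, E[p]^D)`: at `v ∉ T₁`,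
`θ⁻¹(𝓚_v^*) = 𝓚_v` (`dualTransported_kummerSelmerStructure_inr`, from `hEP` and the injectivity of
`inv_v`); at `v ∈ T₁` the localisation is `0`; at infinite places `H¹(K_w, E[p]^D) = 0` for odd `p`.
[cite: MilneADT2006, Ch. I Cor. 3.4 and Thm. 2.8] [cite: Sakamoto2024, §3.1.2 (p. 924)] -/
theorem map_weilDual_mem_dualSelmerGroup_of_kummer_of_eq_zero (hodd : p ≠ 2)
    (inv : LocalInvariants K p) (hinv : ∀ v : HeightOneSpectrum (𝓞 K), Injective (inv (Sum.inr v)))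
    (hEP : ∀ v : HeightOneSpectrum (𝓞 K), localEulerPoincareCharacteristic (v.adicCompletion K))
    {𝓖 : SelmerStructure (W.torsionGaloisModule (p : ℤ))} (T₁ : Finset (HeightOneSpectrum (𝓞 K)))
    (h𝓖off : ∀ v ∉ T₁, 𝓖 (Sum.inr v) = W.kummerSelmerStructure (p : ℤ) (Sum.inr v))
    {y : galoisCohomology (W.torsionGaloisModule (p : ℤ)) 1}
    (hyK : ∀ v ∉ T₁, galoisCohomology.localization (W.torsionGaloisModule (p : ℤ)) (Sum.inr v) 1 y ∈
      W.kummerSelmerStructure (p : ℤ) (Sum.inr v))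
    (hy0 : ∀ v ∈ T₁, galoisCohomology.localization (W.torsionGaloisModule (p : ℤ)) (Sum.inr v) 1 y = 0) :
    galoisCohomology.map (weilDualIntertwining W p e hμ hadd₁ hadd₂ hgal) 1 y ∈
      (inv.dualSelmerStructure (W.torsionGaloisModule (p : ℤ)) 𝓖).selmerGroup := by
  rw [SelmerStructure.mem_selmerGroup_iff]
  intro v
  rw [localization_map_one']
  rcases v with w | v
  · set z := galoisCohomology.map ((weilDualIntertwining W p e hμ hadd₁ hadd₂ hgal).restrictField
      (Place.Completion (Sum.inl w : Place K))) 1 (galoisCohomology.localization _ (Sum.inl w) 1 y)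
    have h0 : z = 0 :=
      galoisCohomology_one_tateDual_torsion_eq_zero_infinitePlace_of_odd W p (hp.out.odd_of_ne_two hodd) w z
    rw [h0]; exact zero_mem _
  · by_cases hv : v ∈ T₁
    · rw [hy0 v hv]
      exact (congrArg (· ∈ inv.dualSelmerStructure (W.torsionGaloisModule (p : ℤ)) 𝓖 (Sum.inr v))
        (map_zero (galoisCohomology.map (ContIntertwiningMap.restrictField
          (Place.Completion (Sum.inr v : Place K)) (weilDualIntertwining W p e hμ hadd₁ hadd₂ hgal)) 1))).mpr
        (zero_mem _)
    · have h := hyK v hv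
      rw [← dualTransported_kummerSelmerStructure_inr W p e hμ hadd₁ hadd₂ hgal halt hnondeg hp.out.isPrimePow
        v (hEP v) inv (hinv v), LocalInvariants.mem_dualTransported_iff] at h
      rw [LocalInvariants.dualSelmerStructure_apply, h𝓖off v hv, ← LocalInvariants.dualSelmerStructure_apply]
      exact h

end Dual

/-! ## §3. The relaxed subgroup with the strict classes counted (number field `K`) -/

section Relaxed

variable {K : Type} [Field K] [NumberField K] {W : WeierstrassCurve K} [W.IsElliptic] {p : ℕ}
  [hp : Fact p.Prime]

/-- **The relaxed-Kummer count with one extra place AND strict classes in the dual Selmer group.**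
As the tree's `X1.GeneratorCountLayerAtP.exists_addSubgroup_relaxedKummer_at` (`p` odd; Poitou–Tate
family `inv`, local Euler–Poincaré `hEP`; Tamagawa witnesses on `T₀`; an extra place `𝔭 ∉ T₀` with a
condition `𝓛 ⊇ 𝓚_𝔭` of index `≥ p`), PLUS a finite family `ycl : ι → H¹(K, E[p])`, injective, of
STRICT classes: Kummer at every finite place off `T₁ = T₀ ∪ {𝔭}` and `0` at the places of `T₁`. Then
the relaxed Selmer group `S = H¹_𝓖(K, E[p])` has **`#S ≥ p^{#T₀+1} · #ι`** (pair counting keeps the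
factor `#H¹_{𝓖*}(K, E[p]^D) ≥ #ι`: the strict classes, pushed through the Weil-pairing transport
`θ_*`, lie in the dual Selmer group — §2), with the same four membership properties.
-- adapted from Summits/BirchSwinnertonDyer/Rank1Residual/X1/GeneratorCountLayerAtP.lean
[cite: GreenbergLNM1716, §5 pp. 114–118] [cite: MilneADT2006, Ch. I Thm. 2.8, Thm. 4.10] -/
theorem exists_addSubgroup_relaxedKummer_at_of_strict (hodd : p ≠ 2)
    (inv : LocalInvariants K p) (hperf : inv.IsPerfect) (hsum : inv.SumLocalTermEqZero)
    (hcompl : inv.SelmerComplement)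
    (hEP : ∀ v : HeightOneSpectrum (𝓞 K), localEulerPoincareCharacteristic (v.adicCompletion K))
    (T₀ : Finset (HeightOneSpectrum (𝓞 K)))
    (hwit : ∀ v ∈ T₀, ∃ u ∈ unramifiedSubgroup
        ((W.torsionGaloisModule (p : ℤ)).restrictField (v.adicCompletion K)) 1,
      u ∉ W.kummerLocalConditionAt (p : ℤ) (v.adicCompletion K))
    (vp : HeightOneSpectrum (𝓞 K)) (hvpT₀ : vp ∉ T₀)
    (𝓛 : ∀ v : HeightOneSpectrum (𝓞 K),
      AddSubgroup (galoisCohomology ((W.torsionGaloisModule (p : ℤ)).toLocal (Sum.inr v)) 1))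
    (h𝓛 : W.kummerSelmerStructure (p : ℤ) (Sum.inr vp) ≤ 𝓛 vp)
    (hidx : p * Nat.card (W.kummerSelmerStructure (p : ℤ) (Sum.inr vp)) ≤ Nat.card (𝓛 vp))
    {ι : Type} [Finite ι] (ycl : ι → galoisCohomology (W.torsionGaloisModule (p : ℤ)) 1)
    (hinj : Injective ycl)
    (hyK : ∀ i, ∀ v ∉ insert vp T₀, galoisCohomology.localization (W.torsionGaloisModule (p : ℤ))
      (Sum.inr v) 1 (ycl i) ∈ W.kummerSelmerStructure (p : ℤ) (Sum.inr v))
    (hy0 : ∀ i, ∀ v ∈ insert vp T₀, galoisCohomology.localization (W.torsionGaloisModule (p : ℤ))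
      (Sum.inr v) 1 (ycl i) = 0) :
    ∃ S : AddSubgroup (galH1Torsion W (p : ℤ)), Finite S ∧ p ^ (T₀.card + 1) * Nat.card ι ≤ Nat.card S ∧
      ∀ y ∈ S,
        (∀ v ∉ (↑(insert vp T₀) : Set (HeightOneSpectrum (𝓞 K))),
            y ∈ selmerLocalKer W (v.adicCompletion K) (p : ℤ)) ∧
        (∀ w : InfinitePlace K, y ∈ selmerLocalKer W w.Completion (p : ℤ)) ∧
        (∀ v ∈ T₀, galoisCohomology.res (W.torsionGaloisModule (p : ℤ)) (v.adicCompletion K) 1 y ∈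
          unramifiedSubgroup ((W.torsionGaloisModule (p : ℤ)).restrictField (v.adicCompletion K)) 1 ⊔
            W.kummerLocalConditionAt (p : ℤ) (v.adicCompletion K)) ∧
        galoisCohomology.localization (W.torsionGaloisModule (p : ℤ)) (Sum.inr vp) 1 y ∈ 𝓛 vp := by
  haveI : NeZero p := ⟨hp.out.ne_zero⟩
  haveI : Finite (geomTorsion W (p : ℤ)) := finite_geomTorsion_of_neZero W p
  -- a finite set `T ⊇ T₀ ∪ {vp} ∪ {bad} ∪ {v ∣ p}` of finite places
  have hbadfin : {v : HeightOneSpectrum (𝓞 K) | ¬ W.HasGoodReductionAt v}.Finite := by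
    have h := W.eventually_hasGoodReductionAt
    rwa [Filter.eventually_cofinite] at h
  have hp0 : (Ideal.span {((p : ℕ) : 𝓞 K)} : Ideal (𝓞 K)) ≠ 0 := by
    rw [Ne, Ideal.zero_eq_bot, Ideal.span_singleton_eq_bot]
    exact_mod_cast hp.out.ne_zero
  have hpfin : {v : HeightOneSpectrum (𝓞 K) | ((p : ℕ) : 𝓞 K) ∈ v.asIdeal}.Finite := by
    refine (Ideal.finite_factors hp0).subset fun v hv ↦ ?_
    exact (Ideal.dvd_span_singleton).mpr hv
  set T₁ : Finset (HeightOneSpectrum (𝓞 K)) := insert vp T₀ with hT₁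
  obtain ⟨T, hT₁T, hTp, hTbad⟩ : ∃ T : Finset (HeightOneSpectrum (𝓞 K)), T₁ ⊆ T ∧
      (∀ v, ((p : ℕ) : 𝓞 K) ∈ v.asIdeal → v ∈ T) ∧ ∀ v, ¬ W.HasGoodReductionAt v → v ∈ T :=
    ⟨T₁ ∪ (hbadfin.toFinset ∪ hpfin.toFinset), Finset.subset_union_left,
      fun v hv ↦ Finset.mem_union_right _ (Finset.mem_union_right _ (hpfin.mem_toFinset.mpr hv)),
      fun v hv ↦ Finset.mem_union_right _ (Finset.mem_union_left _ (hbadfin.mem_toFinset.mpr hv))⟩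
  have hS : ∀ v ∉ T, ((p : ℕ) : 𝓞 K) ∉ v.asIdeal ∧
      GaloisRep.IsUnramifiedAt v (W.torsionGaloisModule (p : ℤ)) := fun v hv ↦ by
    have hpv : ((p : ℕ) : 𝓞 K) ∉ v.asIdeal := fun h ↦ hv (hTp v h)
    have hgood : W.HasGoodReductionAt v := by_contra fun h ↦ hv (hTbad v h)
    exact ⟨hpv, X11b.AcSelmer.isUnramifiedAt_torsionGaloisModule W hgood
      (by rw [Int.cast_natCast]; exact hpv)⟩
  have hfs_p : ∀ v : HeightOneSpectrum (𝓞 K), ((p : ℕ) : 𝓞 K) ∈ v.asIdeal →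
      (Sum.inr v : Place K) ∈ finSupport T := fun v hv ↦ (inr_mem_finSupport_iff T v).mpr (hTp v hv)
  have hfs_bad : ∀ v : HeightOneSpectrum (𝓞 K), ¬ W.HasGoodReductionAt v →
      (Sum.inr v : Place K) ∈ finSupport T := fun v hv ↦ (inr_mem_finSupport_iff T v).mpr (hTbad v hv)
  have h𝓚 : (W.kummerSelmerStructure (p : ℤ)).IsUnramifiedOutside (finSupport T) := by
    have h1 := X11b.KummerDuality.kummerSelmerStructure_isUnramifiedOutside W p 1
      (finSupport T) (inl_mem_finSupport T) hfs_p hfs_bad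
    rwa [pow_one] at h1
  -- the relaxed structure `𝓖`: `𝓛` at `vp`, `H¹_ur + 𝓚_v` on `T₀`, `𝓚_v` elsewhere
  obtain ⟨𝓖, h𝓖inl, h𝓖vp, h𝓖T₀, h𝓖off⟩ : ∃ 𝓖 : SelmerStructure (W.torsionGaloisModule (p : ℤ)),
      (∀ w : InfinitePlace K, 𝓖 (Sum.inl w) = W.kummerSelmerStructure (p : ℤ) (Sum.inl w)) ∧
      𝓖 (Sum.inr vp) = 𝓛 vp ∧
      (∀ v ∈ T₀, 𝓖 (Sum.inr v) =
        unramifiedSubgroup (GaloisRep.toLocal v (W.torsionGaloisModule (p : ℤ))) 1 ⊔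
          W.kummerSelmerStructure (p : ℤ) (Sum.inr v)) ∧
      (∀ v ∉ T₁, 𝓖 (Sum.inr v) = W.kummerSelmerStructure (p : ℤ) (Sum.inr v)) := by
    refine ⟨fun w ↦ match w with
      | Sum.inl w => W.kummerSelmerStructure (p : ℤ) (Sum.inl w)
      | Sum.inr v => if v = vp then 𝓛 v else if v ∈ T₀ then
          unramifiedSubgroup (GaloisRep.toLocal v (W.torsionGaloisModule (p : ℤ))) 1 ⊔
            W.kummerSelmerStructure (p : ℤ) (Sum.inr v)
        else W.kummerSelmerStructure (p : ℤ) (Sum.inr v),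
      fun _ ↦ rfl, if_pos rfl, fun v hv ↦ ?_, fun v hv ↦ ?_⟩
    · have hne : v ≠ vp := fun h ↦ hvpT₀ (h ▸ hv)
      exact (if_neg hne).trans (if_pos hv)
    · have hne : v ≠ vp := fun h ↦ hv (h ▸ Finset.mem_insert_self vp T₀)
      have hv' : v ∉ T₀ := fun h ↦ hv (Finset.mem_insert_of_mem h)
      exact (if_neg hne).trans (if_neg hv')
  have hle : W.kummerSelmerStructure (p : ℤ) ≤ 𝓖 := by
    rintro (w | v)
    · rw [h𝓖inl w]
    · by_cases hv : v = vp
      · subst hv; rw [h𝓖vp]; exact h𝓛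
      by_cases hv' : v ∈ T₀
      · rw [h𝓖T₀ v hv']; exact le_sup_right
      · rw [h𝓖off v (by rw [Finset.mem_insert, not_or]; exact ⟨hv, hv'⟩)]
  have h𝓖ur : 𝓖.IsUnramifiedOutside (finSupport T) := by
    refine ⟨inl_mem_finSupport T, fun v hv ↦ ?_⟩
    have hvT : v ∉ T := fun h ↦ hv ((inr_mem_finSupport_iff T v).mpr h)
    rw [h𝓖off v fun h ↦ hvT (hT₁T h)]
    exact h𝓚.2 v hv
  have hbig : ∀ v ∈ T₁, p * Nat.card (W.kummerSelmerStructure (p : ℤ) (Sum.inr v)) ≤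
      Nat.card (𝓖 (Sum.inr v)) := fun v hv ↦ by
    rcases Finset.mem_insert.mp hv with rfl | hv
    · rw [h𝓖vp]; exact hidx
    · haveI := finite_galoisCohomology_one_toLocal (W.torsionGaloisModule (p : ℤ)) v
      obtain ⟨u, hu, huK⟩ := hwit v hv
      refine Additive.mul_card_le_card_of_lt
        (Additive.smul_galoisCohomology_toLocal_torsion_eq_zero W p v) ?_
      rw [h𝓖T₀ v hv]
      exact right_lt_sup.mpr fun h ↦ huK (h hu)
  -- the strict classes inject into the dual Selmer group `H¹_{𝓖*}(K, E[p]^D)` (Weil pairing)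
  obtain ⟨e, hμ, hadd₁, hadd₂, halt, hnondeg, hgal⟩ :=
    exists_weilPairing_holds W p hp.out.two_le (Nat.cast_ne_zero.mpr hp.out.ne_zero)
  have hinv : ∀ v : HeightOneSpectrum (𝓞 K), Injective (inv (Sum.inr v)) :=
    fun v ↦ (hperf v).1.injective
  have h𝓖off' : ∀ v ∉ T₁, 𝓖 (Sum.inr v) = W.kummerSelmerStructure (p : ℤ) (Sum.inr v) :=
    fun v hv ↦ h𝓖off v hv
  let f : ι → (inv.dualSelmerStructure (W.torsionGaloisModule (p : ℤ)) 𝓖).selmerGroup := fun i ↦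
    ⟨galoisCohomology.map (weilDualIntertwining W p e hμ hadd₁ hadd₂ hgal) 1 (ycl i),
      map_weilDual_mem_dualSelmerGroup_of_kummer_of_eq_zero W p e hμ hadd₁ hadd₂ hgal halt hnondeg hodd
        inv hinv hEP T₁ h𝓖off' (hyK i) (hy0 i)⟩
  have hf : Injective f := fun i j h ↦ hinj
    (map_injective_of_comp_eq _ _ (weilDualInv_weilDualIntertwining W p e hμ hadd₁ hadd₂ hgal hnondeg)
      (congrArg Subtype.val h))
  obtain ⟨hfin, hcard⟩ := pow_mul_le_card_selmerGroup_of_kummer_le W p hodd inv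
    hperf hsum hcompl hEP T hS h𝓚 hle h𝓖ur (fun w ↦ (h𝓖inl w).symm) T₁ hT₁T hbig f hf
  have hcardT₁ : T₁.card = T₀.card + 1 := Finset.card_insert_of_notMem hvpT₀
  refine ⟨𝓖.selmerGroup, hfin, hcardT₁ ▸ hcard,
    fun y hy ↦ ⟨fun v hv ↦ ?_, fun w ↦ ?_, fun v hv ↦ ?_, ?_⟩⟩
  · have hv' : v ∉ T₁ := by rwa [hT₁, ← Finset.mem_coe]
    have h := (𝓖.mem_selmerGroup_iff y).mp hy (Sum.inr v)
    rw [h𝓖off v hv'] at h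
    have h' : y ∈ (W.kummerSelmerStructure (p : ℤ) (Sum.inr v)).comap
        (galoisCohomology.localization (W.torsionGaloisModule (p : ℤ)) (Sum.inr v) 1) := h
    rw [comap_localization_kummerSelmerStructure] at h'
    exact h'
  · have h := (𝓖.mem_selmerGroup_iff y).mp hy (Sum.inl w)
    rw [h𝓖inl w] at h
    have h' : y ∈ (W.kummerSelmerStructure (p : ℤ) (Sum.inl w)).comap
        (galoisCohomology.localization (W.torsionGaloisModule (p : ℤ)) (Sum.inl w) 1) := h
    rw [comap_localization_kummerSelmerStructure] at h'
    exact h'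
  · have h := (𝓖.mem_selmerGroup_iff y).mp hy (Sum.inr v)
    rw [h𝓖T₀ v hv] at h
    exact h
  · have h := (𝓖.mem_selmerGroup_iff y).mp hy (Sum.inr vp)
    rw [h𝓖vp] at h
    exact h

end Relaxed



end Summit.BirchSwinnertonDyer.BirchSwinnertonDyer.Theorems.EisensteinPrimesMazurMCOnCellBKummerCharacterCountStacked

end
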